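import Literature.NumberTheory.Automorphic.UnitaryGroupDoubledSiegelWitness
import Literature.NumberTheory.Automorphic.IntegralMatrixReduction
import HarnessLib

/-!
# The integral big cell of the doubled unitary group over a valued field: lifting a residual witness
# ([GelbartRogawski1991, §3.1 (3.1.3)]; [Kudla1994, §3]; [MoeglinVignerasWaldspurger1987, Chap. 2 II.10])

Topic `NumberTheory/Automorphic`; namespace `Literature.NumberTheory.Automorphic.DoubledUnitary` (sequel of
`UnitaryGroupDoubledSiegelGeneration`).  KERNEL only: definitions with bodies and proved lemmas; no named fact,
no `sorry`.

Setting: `K` a field with a valuative relation (valuation ring `𝒪 = 𝒪[K]`, residue field `𝓀 = 𝓀[K]`), a ring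
involution `σ` of `K` preserving the valuation (so `σ` descends to an involution `σ̄` of `𝓀`, `residueInvolution`),
`θ ∈ 𝒪^×` with `σ θ = −θ` (so `σ̄ θ̄ = −θ̄ ≠ 0`), `|2| = 1`, and `τ ∈ GL_ι(𝒪)` symmetric and `σ`-fixed.  In the
anti-diagonal model `J' = antidiag(τ, τ)` of the doubled hermitian space (`UnitaryGroupDoubledSiegelGeneration`;
`P = ` block-upper Siegel parabolic, `N = {n⁺(y)}`, big cell `{g ∣ g₁₁ invertible}`) we prove the INTEGRAL form of
"moving an element into the big cell" (`exists_integral_skew_valuation_det_eq_one`): **for every `Y ∈ U(σ, J')(𝒪)`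
(integral with integral inverse) there is an INTEGRAL `y` with `τ y + σ(y)ᵀ τ = 0` (i.e. `n⁺(y) ∈ N(𝒪)`) such that
`det (Y₁₁ + y Y₂₁) ∈ 𝒪^×`** (`exists_integral_skew_valuation_det_eq_one'`; the version
`exists_integral_skew_valuation_det_eq_one` isolates the residual statement as a hypothesis `hres`).  Route: reduce `Y`, `τ`, `σ`
modulo `𝓂` (the total reduction map `red` of `IntegralMatrixReduction`), take the residual witness `ȳ`
(`UnitaryGroupDoubledSiegelWitness.exists_skew_isUnit_block₁₁_add` over `𝓀`, for `σ̄`, `θ̄`, `τ̄`), lift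
it to an integral `y₁`, and SKEW-SYMMETRISE: `y = ½ (y₁ − τ⁻¹ σ(y₁)ᵀ τ)` is `τ`-skew, integral, and still reduces
to `ȳ` (because `ȳ` is skew); then `det (Y₁₁ + y Y₂₁)` reduces to `det (Ȳ₁₁ + ȳ Ȳ₂₁) ≠ 0`.

This is the `H(𝒪_v)`-side of the unramified clause «for almost all `v`, `K_v` fixes `Φ_v^0`» of
[GelbartRogawski1991, §3.1 (3.1.3)] for the quasi-split doubled group (stage-1 cell `pub-hodgecm`, seat GR-1, brick
L7a of the [GelbartRogawski1991, Prop. 3.1.1] kernel construction, 2026-08-21): with it, every `k ∈ H(𝒪_v)`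
satisfies `w n⁺(y) k ∈ P(𝒪_v) · w · N(𝒪_v)` [Kudla1994, §3], which is what the big-cell argument of
`ImplementerOmegaEigen` consumes.

## References

* S. Gelbart, J. Rogawski, *L-functions and Fourier–Jacobi coefficients for the unitary group U(3)*, Invent. Math.
  105 (1991) 445–472, §3.1 (3.1.3) [GelbartRogawski1991].
* S. S. Kudla, *Splitting metaplectic covers of dual reductive pairs*, Israel J. Math. 87 (1994) 361–401, §3 [Kudla1994].
* C. Mœglin, M.-F. Vignéras, J.-L. Waldspurger, *Correspondances de Howe sur un corps p-adique*, LNM 1291 (1987),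
  Chap. 2 II.10 [MoeglinVignerasWaldspurger1987].
-/

set_option autoImplicit false

noncomputable section

open scoped Matrix MatrixGroups ValuativeRel
open Matrix ValuativeRel
open Literature.NumberTheory.Automorphic.IntegralReduction

namespace Literature.NumberTheory.Automorphic.DoubledUnitary

variable {K : Type*} [Field K] [ValuativeRel K] {ι : Type*} [Fintype ι] [DecidableEq ι]

/-! ## §1 Skew-symmetrisation -/

section Skew

variable (σ : K →+* K) {τ : Matrix ι ι K}

omit [ValuativeRel K] in
/-- `σ(τ⁻¹) = τ⁻¹` when `σ(τ) = τ`. [cite: Kudla1994, §3] -/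
theorem map_nonsing_inv_eq (hτ : τ.map σ = τ) (hτu : IsUnit τ.det) : τ⁻¹.map σ = τ⁻¹ := by
  refine (Matrix.inv_eq_left_inv ?_).symm
  rw [show τ⁻¹.map σ * τ = τ⁻¹.map σ * τ.map σ by rw [hτ], ← Matrix.map_mul, Matrix.nonsing_inv_mul τ hτu,
    Matrix.map_one σ (map_zero σ) (map_one σ)]

omit [ValuativeRel K] in
/-- **skew-symmetrisation**: for `σ` an involution and `τ` symmetric, `σ`-fixed and invertible, the matrix
`y = ½ (y₁ − τ⁻¹ σ(y₁)ᵀ τ)` satisfies `τ y + σ(y)ᵀ τ = 0`. [cite: Kudla1994, §3 (the unipotent radical of `P_Δ`)] -/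
theorem skew_symmetrise [Invertible (2 : K)] (hσ : ∀ x, σ (σ x) = x) (hσ2 : σ (⅟(2 : K)) = ⅟(2 : K))
    (hτ : τ.map σ = τ) (hτs : τᵀ = τ) (hτu : IsUnit τ.det) (y₁ : Matrix ι ι K) :
    τ * (⅟(2 : K) • (y₁ - τ⁻¹ * (y₁.map σ)ᵀ * τ)) + ((⅟(2 : K) • (y₁ - τ⁻¹ * (y₁.map σ)ᵀ * τ)).map σ)ᵀ * τ = 0 := by
  have hmm : (y₁.map σ).map σ = y₁ := by ext i j; simp [hσ]
  have hσT : ((τ⁻¹ * (y₁.map σ)ᵀ * τ).map σ)ᵀ = τ * y₁ * τ⁻¹ := by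
    rw [Matrix.map_mul, Matrix.map_mul, map_nonsing_inv_eq σ hτ hτu, hτ, Matrix.transpose_mul, Matrix.transpose_mul,
      Matrix.transpose_map, hmm, Matrix.transpose_transpose, hτs, Matrix.transpose_nonsing_inv, hτs, Matrix.mul_assoc]
  have hsm : ((⅟(2 : K) • (y₁ - τ⁻¹ * (y₁.map σ)ᵀ * τ)).map σ)ᵀ = ⅟(2 : K) • ((y₁.map σ)ᵀ - τ * y₁ * τ⁻¹) := by
    rw [Matrix.map_smul' (σ : K → K) _ _ (_root_.map_mul σ), hσ2, Matrix.map_sub (σ : K → K) (map_sub σ), Matrix.transpose_smul,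
      Matrix.transpose_sub, hσT]
  rw [hsm, Matrix.mul_smul, Matrix.smul_mul, ← smul_add, Matrix.mul_sub, Matrix.sub_mul]
  have h1 : τ * (τ⁻¹ * (y₁.map σ)ᵀ * τ) = (y₁.map σ)ᵀ * τ := by
    rw [← Matrix.mul_assoc, ← Matrix.mul_assoc, Matrix.mul_nonsing_inv τ hτu, Matrix.one_mul]
  have h2 : τ * y₁ * τ⁻¹ * τ = τ * y₁ := by
    rw [Matrix.mul_assoc, Matrix.nonsing_inv_mul τ hτu, Matrix.mul_one]
  rw [h1, h2, sub_add_sub_cancel', sub_self, smul_zero]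

end Skew

/-! ## §2 Lifting the residual witness -/

section Lift

variable (σ : K →+* K)

omit [Fintype ι] [DecidableEq ι] in
/-- `|2| = 1` makes `2` invertible with integral inverse. [cite: Kudla1994, §3] -/
theorem invOf_two_mem_integer [Invertible (2 : K)] (h2 : valuation K (2 : K) = 1) : ⅟(2 : K) ∈ 𝒪[K] := by
  rw [Valuation.mem_integer_iff]
  have h : valuation K (⅟(2 : K)) * valuation K 2 = 1 := by rw [← _root_.map_mul, invOf_mul_self, map_one]
  rw [h2, mul_one] at h
  exact h.le

omit [ValuativeRel K] [Fintype ι] [DecidableEq ι] in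
/-- `σ(⅟2) = ⅟2`. [cite: Kudla1994, §3] -/
theorem map_invOf_two' [Invertible (2 : K)] : σ (⅟(2 : K)) = ⅟(2 : K) := by
  have h : (2 : K) * σ (⅟(2 : K)) = 1 :=
    calc (2 : K) * σ (⅟(2 : K)) = σ 2 * σ (⅟(2 : K)) := by rw [map_ofNat]
      _ = σ (2 * ⅟(2 : K)) := (_root_.map_mul σ _ _).symm
      _ = 1 := by rw [mul_invOf_self, map_one]
  exact (invOf_eq_right_inv h).symm

/-- the inverse of an integral matrix with unit determinant is integral (`τ⁻¹ = (det τ)⁻¹ adj τ`). [cite: Kudla1994, §3] -/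
theorem valBound_one_nonsing_inv {τ : Matrix ι ι K} (hτi : ValBound 1 τ) (hτd : valuation K τ.det = 1) :
    ValBound 1 τ⁻¹ := by
  intro i j
  rw [Matrix.inv_def, Ring.inverse_eq_inv', Matrix.smul_apply, smul_eq_mul, _root_.map_mul, map_inv₀, hτd, inv_one, one_mul]
  exact valBound_one_adjugate hτi i j

/-- an integral matrix whose inverse is integral reduces to an invertible matrix. [cite: Kudla1994, §3] -/
theorem isUnit_redMat_of_mul_eq_one {m : Type*} [Fintype m] [DecidableEq m] {Y Y' : Matrix m m K}
    (hYi : ValBound 1 Y) (hY'i : ValBound 1 Y') (hYY' : Y * Y' = 1) : IsUnit (redMat Y) :=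
  IsUnit.of_mul_eq_one (redMat Y') (by rw [← redMat_mul hYi hY'i, hYY', redMat_one])

/-- **LIFTING THE RESIDUAL WITNESS.** `σ` an involution of the valued field `K` preserving the valuation, `|2| = 1`,
`τ ∈ GL_ι(𝒪)` symmetric and `σ`-fixed; `Y ∈ U(σ, antidiag(τ, τ))` integral with integral inverse.  If over the
residue field every element of `U(σ̄, antidiag(τ̄, τ̄))(𝓀)` can be moved into the big cell by some `n⁺(yb)`
(hypothesis `hres` — the field-level statement of `UnitaryGroupDoubledSiegelGeneration`), then there is an INTEGRAL
`τ`-skew `y` with `det (Y₁₁ + y Y₂₁) ∈ 𝒪^×`. [cite: GelbartRogawski1991, §3.1 (3.1.3); Kudla1994, §3] -/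
theorem exists_integral_skew_valuation_det_eq_one [Invertible (2 : K)] (hσv : ∀ x, valuation K (σ x) = valuation K x)
    (hσ : ∀ x, σ (σ x) = x) (h2 : valuation K (2 : K) = 1)
    {τ : Matrix ι ι K} (hτσ : τ.map σ = τ) (hτs : τᵀ = τ) (hτi : ValBound 1 τ) (hτd : valuation K τ.det = 1)
    {Y Y' : Matrix (ι ⊕ ι) (ι ⊕ ι) K} (hYi : ValBound 1 Y) (hY'i : ValBound 1 Y') (hYY' : Y * Y' = 1)
    (hY : (Y.map σ)ᵀ * antidiagForm τ * Y = antidiagForm τ)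
    (hres : ∀ g : GL (ι ⊕ ι) 𝓀[K], g ∈ unitaryGroupOfForm (residueInvolution σ hσv) (antidiagForm (redMat τ)) →
      ∃ yb : Matrix ι ι 𝓀[K], redMat τ * yb + (yb.map (residueInvolution σ hσv))ᵀ * redMat τ = 0 ∧
        IsUnit ((g : Matrix (ι ⊕ ι) (ι ⊕ ι) 𝓀[K]).toBlocks₁₁ + yb * (g : Matrix (ι ⊕ ι) (ι ⊕ ι) 𝓀[K]).toBlocks₂₁)) :
    ∃ y : Matrix ι ι K, ValBound 1 y ∧ τ * y + (y.map σ)ᵀ * τ = 0 ∧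
      valuation K (Y.toBlocks₁₁ + y * Y.toBlocks₂₁).det = 1 := by
  set σb := residueInvolution σ hσv with hσb
  -- the reduction `Ȳ` as an element of `GL(𝓀)` in `U(σ̄, antidiag(τ̄, τ̄))`
  have hYu : IsUnit (redMat Y) := isUnit_redMat_of_mul_eq_one hYi hY'i hYY'
  set g : GL (ι ⊕ ι) 𝓀[K] := hYu.unit with hg
  have hgc : (g : Matrix (ι ⊕ ι) (ι ⊕ ι) 𝓀[K]) = redMat Y := hYu.unit_spec
  have hτ0 : ValBound 1 (0 : Matrix ι ι K) := valBound_zero 1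
  have hJi : ValBound 1 (antidiagForm τ) := by
    rintro (i | i) (j | j)
    · simp [antidiagForm]
    · exact hτi i j
    · exact hτi i j
    · simp [antidiagForm]
  have hredJ : redMat (antidiagForm τ) = antidiagForm (redMat τ) := by
    rw [antidiagForm, redMat_fromBlocks, redMat_zero]; rfl
  have hYσi : ValBound 1 (Y.map σ)ᵀ := fun i j => by
    rw [Matrix.transpose_apply, Matrix.map_apply, hσv]; exact hYi j i
  have hmem : g ∈ unitaryGroupOfForm σb (antidiagForm (redMat τ)) := by
    rw [mem_unitaryGroupOfForm_iff, hgc, ← redMat_map σ hσv (fun i j => (Valuation.mem_integer_iff _ _).2 (hYi i j)),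
      ← redMat_transpose, ← hredJ, ← redMat_mul hYσi hJi, ← redMat_mul (hYσi.mul hJi |>.mono (by rw [one_mul])) hYi, hY]
  -- the residual witness
  obtain ⟨yb, hybskew, hybunit⟩ := hres g hmem
  rw [hgc, redMat_toBlocks₁₁, redMat_toBlocks₂₁] at hybunit
  -- lift `yb` to an integral `y₁`
  obtain ⟨y₀, hy₀⟩ : ∃ y₀ : Matrix ι ι 𝒪[K], (IsLocalRing.residue 𝒪[K]).mapMatrix y₀ = yb :=
    ⟨yb.map (Function.surjInv IsLocalRing.residue_surjective), by
      ext i j; exact Function.surjInv_eq IsLocalRing.residue_surjective (yb i j)⟩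
  set y₁ : Matrix ι ι K := (𝒪[K]).subtype.mapMatrix y₀ with hy₁
  have hy₁i : ValBound 1 y₁ := fun i j => (Valuation.mem_integer_iff _ _).1 (y₀ i j).2
  have hredy₁ : redMat y₁ = yb := by rw [hy₁, redMat_mapMatrix, hy₀]
  -- skew-symmetrise
  have hτu : IsUnit τ.det := isUnit_iff_ne_zero.2 fun h => by rw [h, map_zero] at hτd; exact zero_ne_one hτd
  set y : Matrix ι ι K := ⅟(2 : K) • (y₁ - τ⁻¹ * (y₁.map σ)ᵀ * τ) with hy
  have hτinv : ValBound 1 τ⁻¹ := valBound_one_nonsing_inv hτi hτd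
  have hy₁σ : ValBound 1 (y₁.map σ)ᵀ := fun i j => by rw [Matrix.transpose_apply, Matrix.map_apply, hσv]; exact hy₁i j i
  have hinner : ValBound 1 (τ⁻¹ * (y₁.map σ)ᵀ * τ) := by
    have := (hτinv.mul hy₁σ).mul hτi
    rwa [one_mul, one_mul] at this
  have hdiff : ValBound 1 (y₁ - τ⁻¹ * (y₁.map σ)ᵀ * τ) := hy₁i.sub hinner
  have hyi : ValBound 1 y := by
    intro i j
    rw [hy, Matrix.smul_apply, smul_eq_mul, _root_.map_mul]
    exact mul_le_one' ((Valuation.mem_integer_iff _ _).1 (invOf_two_mem_integer h2)) (hdiff i j)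
  have hyskew : τ * y + (y.map σ)ᵀ * τ = 0 := skew_symmetrise σ hσ (map_invOf_two' σ) hτσ hτs hτu y₁
  -- `y` still reduces to `yb`
  have hτbu : IsUnit (redMat τ).det := by
    rw [← red_det hτi]; exact isUnit_iff_ne_zero.2 (red_ne_zero_of_valuation_eq_one hτd)
  have hredinv : redMat τ⁻¹ = (redMat τ)⁻¹ := by
    refine Matrix.inv_eq_left_inv ?_ |>.symm
    rw [← redMat_mul hτinv hτi, Matrix.nonsing_inv_mul τ hτu, redMat_one]
  have hredy : redMat y = yb := by
    have h2mem : (2 : K) ∈ 𝒪[K] := (Valuation.mem_integer_iff _ _).2 h2.le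
    have h2u : red (⅟(2 : K)) * 2 = 1 := by
      rw [← red_two, ← red_mul (invOf_two_mem_integer h2) h2mem, invOf_mul_self, red_one]
    rw [hy, redMat_smul (invOf_two_mem_integer h2) hdiff, redMat_sub hy₁i hinner, redMat_mul (by
      have := hτinv.mul hy₁σ; rwa [one_mul] at this) hτi, redMat_mul hτinv hy₁σ, redMat_transpose,
      redMat_map σ hσv (fun i j => (Valuation.mem_integer_iff _ _).2 (hy₁i i j)), hredy₁, hredinv]
    -- `τ̄⁻¹ ybᴴ τ̄ = -yb` from the skewness of `yb`
    have hsk : (redMat τ)⁻¹ * (yb.map σb)ᵀ * redMat τ = -yb := by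
      have h1 : (yb.map σb)ᵀ * redMat τ = -(redMat τ * yb) := eq_neg_of_add_eq_zero_right hybskew
      rw [Matrix.mul_assoc, h1, Matrix.mul_neg, ← Matrix.mul_assoc, Matrix.nonsing_inv_mul _ hτbu, Matrix.one_mul]
    rw [hsk, sub_neg_eq_add, ← two_smul 𝓀[K] yb, smul_smul, h2u, one_smul]
  -- the determinant
  refine ⟨y, hyi, hyskew, ?_⟩
  obtain ⟨hAi, -, hCi, -⟩ := valBound_toBlocks hYi
  have hXi : ValBound 1 (Y.toBlocks₁₁ + y * Y.toBlocks₂₁) := by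
    have := hyi.mul hCi; rw [one_mul] at this
    exact hAi.add this
  refine valuation_eq_one_of_red_ne_zero ((Valuation.mem_integer_iff _ _).2 (valuation_det_le_one hXi)) ?_
  rw [red_det hXi, redMat_add hAi (by have := hyi.mul hCi; rwa [one_mul] at this), redMat_mul hyi hCi, hredy]
  exact (Matrix.isUnit_iff_isUnit_det _ |>.1 hybunit).ne_zero

/-- **LIFTING THE RESIDUAL WITNESS, unconditional form**: with `θ ∈ 𝒪^×`, `σ θ = −θ` (so that over the residue
field `σ̄ θ̄ = −θ̄ ≠ 0` and `UnitaryGroupDoubledSiegelWitness.exists_skew_isUnit_block₁₁_add` supplies the residual witness),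
every `Y ∈ U(σ, antidiag(τ, τ))(𝒪)` admits an integral `τ`-skew `y` with `det (Y₁₁ + y Y₂₁) ∈ 𝒪^×`.
[cite: GelbartRogawski1991, §3.1 (3.1.3); Kudla1994, §3] -/
theorem exists_integral_skew_valuation_det_eq_one' [Invertible (2 : K)] (hσv : ∀ x, valuation K (σ x) = valuation K x)
    (hσ : ∀ x, σ (σ x) = x) (h2 : valuation K (2 : K) = 1) {θ : K} (hθ : σ θ = -θ) (hθ1 : valuation K θ = 1)
    {τ : Matrix ι ι K} (hτσ : τ.map σ = τ) (hτs : τᵀ = τ) (hτi : ValBound 1 τ) (hτd : valuation K τ.det = 1)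
    {Y Y' : Matrix (ι ⊕ ι) (ι ⊕ ι) K} (hYi : ValBound 1 Y) (hY'i : ValBound 1 Y') (hYY' : Y * Y' = 1)
    (hY : (Y.map σ)ᵀ * antidiagForm τ * Y = antidiagForm τ) :
    ∃ y : Matrix ι ι K, ValBound 1 y ∧ τ * y + (y.map σ)ᵀ * τ = 0 ∧
      valuation K (Y.toBlocks₁₁ + y * Y.toBlocks₂₁).det = 1 := by
  refine exists_integral_skew_valuation_det_eq_one σ hσv hσ h2 hτσ hτs hτi hτd hYi hY'i hYY' hY fun g hg => ?_
  have hθmem : θ ∈ 𝒪[K] := (Valuation.mem_integer_iff _ _).2 hθ1.le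
  have hθb : residueInvolution σ hσv (red θ) = -red θ := by
    rw [residueInvolution_red σ hσv hθmem, hθ, red_neg hθmem]
  have hθb0 : red θ ≠ 0 := red_ne_zero_of_valuation_eq_one hθ1
  have hτbσ : (redMat τ).map (residueInvolution σ hσv) = redMat τ := by
    rw [← redMat_map σ hσv (fun i j => (Valuation.mem_integer_iff _ _).2 (hτi i j)), hτσ]
  have hτbs : (redMat τ)ᵀ = redMat τ := by rw [← redMat_transpose, hτs]
  have hτbu : IsUnit (redMat τ).det := by
    rw [← red_det hτi]; exact isUnit_iff_ne_zero.2 (red_ne_zero_of_valuation_eq_one hτd)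
  exact exists_skew_isUnit_block₁₁_add (residueInvolution σ hσv) (residueInvolution_involutive σ hσv hσ) hθb hθb0
    hτbσ hτbs hτbu hg

end Lift

end Literature.NumberTheory.Automorphic.DoubledUnitary

end
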